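import Literature.NumberTheory.EllipticCurves.KuriharaNumberKimStructure
import Literature.NumberTheory.EllipticCurves.KatoRankBoundLevelZeroProofs
import Literature.NumberTheory.EllipticCurves.MazurTateElementKuriharaCoefficient
import Literature.NumberTheory.EllipticCurves.BSDSelmerPConverseSerreProofs
import HarnessLib

/-!
# Kim's structure theorem, corank clause, upper direction: the level `ν(n) = 0`, and the levels `ν(n) < p` modulo the Mazur–Tate order of vanishing

`Proofs` companion (theorems only: no definition, no new named fact) of
`Literature.NumberTheory.EllipticCurves.KuriharaNumberKimStructure` for the named fact
`Literature.NumberTheory.EllipticCurves.Kim2022_selmerCorank_le_of_kuriharaNumber_ne_zero`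
(C.-H. Kim, *The structure of Selmer groups and the Iwasawa main conjecture for elliptic curves*,
arXiv:2203.12159 = Amer. J. Math. (2026), **Thm. 1.9 (1)**, PDF p. 7, upper direction: a non-zero
Kurihara number `δ̃_n^{(k)}` at `n ∈ 𝒩_k` bounds `cork_{ℤ_p} Sel(ℚ, E[p^∞]) ≤ ν(n)`).

## Status of the fact (literature-prover triage 2026-08-17: size XL, not discharged)

The printed proof of Thm. 1.9 (1) (§5 of the source, PDF pp. 23–27: Prop. 5.5, Thm. 5.6,
Prop. 5.8, Cor. 5.10, Lemma 5.12, Prop. 5.13) runs through Kato's Kolyvagin system `κ^{Kato}`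
for `T = T_pE` (Kato 2004; Mazur–Rubin 2004, Thm. 3.2.4), the explicit reciprocity law in
Kolyvagin-derived form `exp*_{ω_E}(loc^s_p κ^{Kato}_n) = u · p^t · δ̃_n` in `ℤ_p/I_nℤ_p`
(Thm. 3.13 of the source, after Kurihara 2014), the Mazur–Rubin structure theorem for the
`p`-strict Selmer groups `Sel_0` ("`cork Sel_0(ℚ, E[p^∞]) = ord(κ^{Kato})`", Thm. 4.x of the source),
the global Poitou–Tate comparison of `Sel` with `Sel_0` (§5.1, §5.3), a generalised Cassels–Tate
pairing (Thm. 5.2, Howard/Flach) and Chebotarev-chosen useful Kolyvagin primes (Prop. 2.3). None of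
these exists in Mathlib or in this tree beyond the DEFINITION of an Euler system
(`Literature.NumberTheory.GaloisRepresentations.EulerSystem`); even their statements would need
notions the tree lacks (Kolyvagin systems, Selmer structures `𝓕(n)`, `H¹(ℚ, T/I_nT)`, `exp*`).

## What this file proves: the level `ν(n) = 0`, i.e. `n = 1`

At `n = 1` the fact is Kato's finiteness theorem. By `kuriharaNumber_one`,
`δ_1 = \overline{[0]⁺_f}` (Kim, §1.4.3, p. 7: "When `n = 1`, we have `δ̃_1 = [0]⁺ = L(E,1)/Ω⁺_E`"),
so `δ_1 ≠ 0 (mod p^k)` forces `[0]⁺_f ≠ 0`, i.e. `L(E,1) = [0]⁺_f · Ω⁺_f ≠ 0`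
(`IsNewformOf.entireLFunction_one_eq`, `Ω⁺_f > 0` by `IsNewform0.plusPeriod_pos_holds`), and then
`Sel_{p^∞}(E/ℚ)` is finite — Kato, Astérisque 295 (2004), Cor. 14.3 (p. 235), the tree's named
fact `kato_finite_of_L_one_ne_zero W p` — so `cork_{ℤ_p} Sel_{p^∞}(E/ℚ) = 0 = ν(1)`
(`selmerCorank_eq_zero_of_entireLFunction_one_ne_zero`, file `KatoRankBoundLevelZeroProofs`).
This is also how the source itself treats corank zero (Thm. 5.6, p. 24: "If `p^t · δ̃_1 ≠ 0`, then
`κ^{Kato}_1` is non-zero, so `Sel_0(ℚ, E[p^∞])` is finite by [the Euler-system divisibility]").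

* `ratPlusSymbol_zero_ne_zero_of_kuriharaNumber_one_ne_zero` — `δ_1 ≠ 0 ⇒ [0]⁺_f ≠ 0` (any `f`,
  any modulus, any discrete logarithms).
* `IsNewformOf.entireLFunction_one_ne_zero_of_ratPlusSymbol_zero_ne_zero` — `[0]⁺_f ≠ 0 ⇒
  L(E,1) ≠ 0` for the newform `f` of `E`.
* `selmerCorank_eq_zero_of_kuriharaNumber_one_ne_zero` — granting Kato's Cor. 14.3 at `(W, p)`,
  `δ_1 ≠ 0 (mod m) ⇒ cork_{ℤ_p} Sel_{p^∞}(E/ℚ) = 0`.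
* `Kim2022_selmerCorank_le_of_kuriharaNumber_ne_zero_one_of_kato` — **the fact at `n = 1`**, with
  all its binders, from `kato_finite_of_L_one_ne_zero` (universally quantified over `(W, p)`);
  `…_one_of_gzk` — the same from Gross–Zagier–Kolyvagin (bsd.S17,
  `rank_eq_analyticRank_of_analyticRank_le_one`), which supplies Kato's Cor. 14.3 in the tree
  (`kato_finite_of_L_one_ne_zero_of_rank_eq_analyticRank`, file `PAdicBSDKatoFiniteProofs`).

Not here: any level `ν(n) ≥ 1` by the printed route (the Kolyvagin-system content above); no
`_holds`.

## What this file proves: the levels `ν(n) < p`, granted the order of vanishing of `θ̃_{ℚ(μ_n)}`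

A second, printed, road to the UPPER direction at higher levels avoids Kolyvagin systems for the
classical Selmer group altogether: the Kurihara number `δ_n` is the top Taylor coefficient of the
Mazur–Tate modular element `θ̃_{ℚ(μ_n)} = ∑_a [a/n]⁺ δ_a` (Kurihara 2014, §1.1 (1)–(2); Kim 2022,
§3.5; tree: `modularElement`, `taylorCoeff_univ_eq_kuriharaNumber`,
file `MazurTateElementKuriharaCoefficient`), and a Taylor coefficient indexed by `ν(n)` primes kills
the power `I^{ν(n)+1}` of the augmentation ideal (`MazurTate.taylorCoeff_eq_zero_of_mem_pow`). Hence
ANY theorem "`θ̃_{ℚ(μ_n)} ∈ I^r ⊗ ℤ_p`" gives "`δ_n ≠ 0 ⇒ r ≤ ν(n)`". With `r = cork_{ℤ_p}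
Sel_{p^∞}(E/ℚ)` this is exactly the conclusion of the fact; with `r = min(cork, p)` it is the
conclusion for `ν(n) < p`. The latter bound IS a theorem in print — K. Ota, Amer. J. Math. 140
(2018) = arXiv:1509.00682, **Thm. 5.17** (PDF p. 21): "We suppose that `p` does not divide
`6N · |E(𝔽_p)| ∏_{ℓ∣N} m_ℓ` and the Galois representation `G_ℚ → Aut_{ℤ_p}(T_p(E))` is surjective.
Let `S` be a square-free product of good primes `ℓ` such that `E(𝔽_ℓ)[p]` is isomorphic to `ℤ/pℤ`
or `0`. Then, we have `θ_S ∈ I_{G_S}^{min{r_{p^∞}, p}} ⊆ ℤ_p[G_S]`" (`r_{p^∞}` the Selmer corank;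
proof by divisibility of Darmon–Kolyvagin derivatives of Kato's Euler system plus `p`-parity) —
under hypotheses slightly stronger than the fact's at `p` (non-anomalous: `p ∤ #Ẽ(𝔽_p)`;
`p ∤ Tam(E)`; `ρ_{E,p^∞}` onto, which for `p ≥ 5` follows from `ρ̄_{E,p}` onto by
`serre_hasSurjectiveModNGaloisRep_pow_holds`) and at the level (`E(𝔽_ℓ)[p]` cyclic for `ℓ ∣ n`,
i.e. `ℓ` not completely split in `ℚ(E[p])` — Mazur–Rubin's "`T/(Fr_ℓ - 1)T` cyclic", listed by
Kim as a hypothesis of his Thm. 2.1 but not part of his (nor the tree's, `Kato.IsKolyvaginPrime`)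
definition of `𝒫_k`). Ota's theorem is not vendored as a named fact by this file (a proving seat
may not mint facts, D-0026; a ready transcription `ota_modularElement_mem_augIdeal_pow` — plus part,
`Ω⁺_f`-normalisation, the two-line derivation from the printed `θ_S` recorded there — awaits a
planner); the theorems below take its CONCLUSION at `(E, p, n)` as an explicit hypothesis:

* `le_card_primeFactors_of_kuriharaNumber_ne_zero_of_mem_pow_min` — `Θ ∈ I^{min(r,p)}`,
  `ν(n) < p`, `δ_n ≠ 0 ⇒ r ≤ ν(n)` (pure algebra);
* `Kim2022_selmerCorank_le_of_kuriharaNumber_ne_zero_of_mazurTateOrder` — **the fact at all levels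
  `n` with `ν(n) < p`**, binder for binder, granting Ota's conclusion at `(W, p, n)`;
* `Kim2022_selmerCorank_le_of_kuriharaNumber_ne_zero_of_mazurTateOrder'` — the fact at ALL
  levels, granting the untruncated bound `θ̃_{ℚ(μ_n)} ∈ I^{cork} ⊗ ℤ_p` (the Selmer-corank form of
  the Mazur–Tate "weak vanishing" conjecture, Mazur–Tate 1987, Conj.; Ota 2018, Conj. 1.1 with
  `r_{p^∞}` for `r_E`; open beyond order `p`).
* `Kim2022_selmerCorank_le_of_kuriharaNumber_ne_zero_of_otaStatement` — **the fact at all levels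
  `ν(n) < p` under Ota's three extra hypotheses** (`p ∤ #Ẽ(𝔽_p)`, `p ∤ Tam(E)`, `#Ẽ(𝔽_ℓ)[p] ≤ p`
  for `ℓ ∣ n`), granting Ota's Thm. 5.17 ITSELF — its transcription spelled out as a universally
  quantified hypothesis `hOta` (word for word the statement prepared for the named fact
  `ota_modularElement_mem_augIdeal_pow`): the fact's own hypotheses supply Ota's remaining ones
  (`p ∤ N_E` from good reduction, `not_dvd_conductorNorm_of_hasGoodReductionAtPrime`; `ρ_{E,p^∞}`
  onto from `ρ̄_{E,p}` onto and `p ≥ 5`, `serre_hasSurjectiveModNGaloisRep_pow_holds`; `n`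
  square-free with prime factors `ℓ ∤ N_E`, `Kato.IsKolyvaginProduct`). Once the named fact exists,
  this theorem applied to its `_holds` is the unconditional slice.

## References

* [Kim2022StructureSelmer] C.-H. Kim, arXiv:2203.12159 (Amer. J. Math. 2026): Thm. 1.9 (1)
  (p. 7), §1.4.3 (p. 7), §5 and Thm. 5.6 (pp. 23–24).
* [Kato2004Asterisque] K. Kato, Astérisque 295 (2004): Thm. 14.2 (2), Cor. 14.3 (p. 235).
* [MazurTateTeitelbaum1986Invent] B. Mazur, J. Tate, J. Teitelbaum, Invent. Math. 84 (1986),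
  §I.8 (`[0]⁺ = L(f,1)/Ω⁺`).
* [Ota2018] K. Ota, Amer. J. Math. 140 (2018), 495–542 = arXiv:1509.00682: Thm. 5.17 (§5.5,
  PDF p. 21), Def. 2.1, §5.1; Conj. 1.1 (Mazur–Tate).
* [Kurihara2014] M. Kurihara, arXiv:1407.2465, §1.1 (1)–(2).
-/

open scoped MatrixGroups ModularForm

open CongruenceSubgroup Literature.NumberTheory.EllipticCurves.ModularForms

open Literature.NumberTheory.DiophantineGeometry.Dioph (ratModP)

namespace Literature.NumberTheory.EllipticCurves

/-! ### `δ_1 ≠ 0` forces `L(E,1) ≠ 0` -/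

section DeltaOne

variable {N : ℕ} (f : CuspForm (Gamma0 N) 2)

/-- **`δ_1 ≠ 0 ⇒ [0]⁺_f ≠ 0`.** At level `n = 1` the Kurihara number is the reduction of the
single symbol `[0]⁺_f` (`kuriharaNumber_one`; Kim 2022, §1.4.3: "When `n = 1`, we have
`δ̃_1 = [0]⁺`"), and the reduction of `0` is `0` (`ratModP_zero`).
[cite: Kim2022StructureSelmer, §1.4.3 (PDF p. 7)] -/
theorem ratPlusSymbol_zero_ne_zero_of_kuriharaNumber_one_ne_zero (m : ℕ)
    (ψ : (ℓ : ℕ) → (ZMod ℓ)ˣ →* Multiplicative (ZMod m)) (h : kuriharaNumber f m 1 ψ ≠ 0) :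
    ratPlusSymbol f 0 ≠ 0 := by
  intro h0
  apply h
  rw [kuriharaNumber_one, h0, ratModP_zero]

end DeltaOne

end Literature.NumberTheory.EllipticCurves

namespace Literature.NumberTheory.EllipticCurves.ModularForms

section LValue

variable {N : ℕ} [NeZero N] {f : CuspForm (Gamma0 N) 2} {W : WeierstrassCurve ℚ} [W.IsElliptic]

/-- **`[0]⁺_f ≠ 0 ⇒ L(E,1) ≠ 0`** for the newform `f` of `E`: `L(E,1) = [0]⁺_f · Ω⁺_f`
(`IsNewformOf.entireLFunction_one_eq`; Mazur–Tate–Teitelbaum 1986, §I.8) with `Ω⁺_f > 0`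
(`IsNewform0.plusPeriod_pos_holds`). [cite: MazurTateTeitelbaum1986Invent, §I.8 (8.6)] -/
theorem IsNewformOf.entireLFunction_one_ne_zero_of_ratPlusSymbol_zero_ne_zero
    (hf : IsNewformOf W f) (h : ratPlusSymbol f 0 ≠ 0) : W.entireLFunction 1 ≠ 0 := by
  have hpos : 0 < plusPeriod f := IsNewform0.plusPeriod_pos_holds hf.1 hf.coeffField_eq_bot
  have hre : ((ratPlusSymbol f 0 : ℚ) : ℝ) * plusPeriod f ≠ 0 :=
    mul_ne_zero (by exact_mod_cast h) hpos.ne'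
  rw [hf.entireLFunction_one_eq]
  exact_mod_cast hre

end LValue

end Literature.NumberTheory.EllipticCurves.ModularForms

namespace Literature.NumberTheory.EllipticCurves

/-! ### The level-zero case of the fact, from Kato's Cor. 14.3 -/

section LevelZero

variable (W : WeierstrassCurve ℚ) [W.IsElliptic] [W.IsGloballyMinimal] (p : ℕ) [Fact p.Prime]
  {N : ℕ} [NeZero N] {f : CuspForm (Gamma0 N) 2}

omit [W.IsGloballyMinimal] in
/-- **`δ_1 ≠ 0 ⇒ cork_{ℤ_p} Sel_{p^∞}(E/ℚ) = 0`**, granting Kato's Cor. 14.3 at `(W, p)`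
(`kato_finite_of_L_one_ne_zero W p`: "`L(E,1) ≠ 0 ⇒ Sel_{p^∞}(E/ℚ)` finite"): `δ_1 ≠ 0` gives
`L(E,1) ≠ 0` (`ratPlusSymbol_zero_ne_zero_of_kuriharaNumber_one_ne_zero`,
`IsNewformOf.entireLFunction_one_ne_zero_of_ratPlusSymbol_zero_ne_zero`), whence a finite Selmer
group of corank `0` (`selmerCorank_eq_zero_of_entireLFunction_one_ne_zero`). This is the corank-zero
step of the source (Thm. 5.6, (1) ⇒ (2)). [cite: Kim2022StructureSelmer, Thm. 5.6 (PDF p. 24)]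
[cite: Kato2004Asterisque, Cor. 14.3 (p. 235)] -/
theorem selmerCorank_eq_zero_of_kuriharaNumber_one_ne_zero
    (hKF : kato_finite_of_L_one_ne_zero W p) (hf : IsNewformOf W f) (m : ℕ)
    (ψ : (ℓ : ℕ) → (ZMod ℓ)ˣ →* Multiplicative (ZMod m)) (h : kuriharaNumber f m 1 ψ ≠ 0) :
    W.selmerCorank p = 0 :=
  selmerCorank_eq_zero_of_entireLFunction_one_ne_zero W p hKF
    (hf.entireLFunction_one_ne_zero_of_ratPlusSymbol_zero_ne_zero
      (ratPlusSymbol_zero_ne_zero_of_kuriharaNumber_one_ne_zero f m ψ h))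

end LevelZero

/-! ### The fact at `n = 1`, binder for binder -/

section Assembly

/-- **Kim 2022, Thm. 1.9 (1), upper direction, at the level `ν(n) = 0` (`n = 1`), from Kato's
Cor. 14.3.** With every binder of `Kim2022_selmerCorank_le_of_kuriharaNumber_ne_zero` in place and
`n` specialised to `1` (`1 ∈ 𝒩_k`, `Kato.IsKolyvaginProduct.one`): if
`kuriharaNumber f (p^k) 1 ψ ≠ 0` then `cork_{ℤ_p} Sel_{p^∞}(E/ℚ) ≤ ν(1) = 0`, granting
`kato_finite_of_L_one_ne_zero` at every `(W, p)` (Kato 2004, Cor. 14.3). The hypotheses `5 ≤ p`,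
good ordinary reduction, surjectivity of `ρ̄`, the period transfer, `1 ≤ k`, `n ∈ 𝒩_k` and the
surjectivity of the `ψ_ℓ` are not used at this level (they are kept to match the fact).
[cite: Kim2022StructureSelmer, Thm. 1.9 (1) (PDF p. 7) and Thm. 5.6 (PDF p. 24)]
[cite: Kato2004Asterisque, Cor. 14.3 (p. 235)] -/
theorem Kim2022_selmerCorank_le_of_kuriharaNumber_ne_zero_one_of_kato
    (hKF : ∀ (W : WeierstrassCurve ℚ) [W.IsElliptic] [W.IsGloballyMinimal] (p : ℕ) [Fact p.Prime],
      kato_finite_of_L_one_ne_zero W p)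
    (W : WeierstrassCurve ℚ) [W.IsElliptic] [W.IsGloballyMinimal] (p : ℕ) [Fact p.Prime]
    (_hp : 5 ≤ p) (_hgood : W.HasGoodReductionAtPrime p) (_hord : ¬ (p : ℤ) ∣ W.frobeniusTrace p)
    (_hsurj : W.HasSurjectiveModNGaloisRep p)
    {N : ℕ} [NeZero N] (f : CuspForm (CongruenceSubgroup.Gamma0 N) 2) (hf : IsNewformOf W f)
    (_hper : ∃ u : ℚ, ‖(u : ℚ_[p])‖ = 1 ∧ W.realPeriodRat = u * plusPeriod f)
    (k : ℕ) (_hk : 1 ≤ k) (_hn : Kato.IsKolyvaginProduct W p k 1)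
    (ψ : (ℓ : ℕ) → (ZMod ℓ)ˣ →* Multiplicative (ZMod (p ^ k)))
    (_hψ : ∀ ℓ ∈ (1 : ℕ).primeFactors, Function.Surjective (ψ ℓ))
    (h : kuriharaNumber f (p ^ k) 1 ψ ≠ 0) :
    W.selmerCorank p ≤ (1 : ℕ).primeFactors.card := by
  rw [selmerCorank_eq_zero_of_kuriharaNumber_one_ne_zero W p (hKF W p) hf (p ^ k) ψ h]
  exact Nat.zero_le _

/-- **The same level-zero case from Gross–Zagier–Kolyvagin** (bsd.S17,
`rank_eq_analyticRank_of_analyticRank_le_one`), which supplies Kato's Cor. 14.3 at every `(W, p)`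
in the tree (`kato_finite_of_L_one_ne_zero_of_rank_eq_analyticRank`, file `PAdicBSDKatoFiniteProofs`).
[cite: Darmon2004, Thm. 3.22]
[cite: Kim2022StructureSelmer, Thm. 1.9 (1) (PDF p. 7)] -/
theorem Kim2022_selmerCorank_le_of_kuriharaNumber_ne_zero_one_of_gzk
    (hGZK : rank_eq_analyticRank_of_analyticRank_le_one)
    (W : WeierstrassCurve ℚ) [W.IsElliptic] [W.IsGloballyMinimal] (p : ℕ) [Fact p.Prime]
    (hp : 5 ≤ p) (hgood : W.HasGoodReductionAtPrime p) (hord : ¬ (p : ℤ) ∣ W.frobeniusTrace p)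
    (hsurj : W.HasSurjectiveModNGaloisRep p)
    {N : ℕ} [NeZero N] (f : CuspForm (CongruenceSubgroup.Gamma0 N) 2) (hf : IsNewformOf W f)
    (hper : ∃ u : ℚ, ‖(u : ℚ_[p])‖ = 1 ∧ W.realPeriodRat = u * plusPeriod f)
    (k : ℕ) (hk : 1 ≤ k) (hn : Kato.IsKolyvaginProduct W p k 1)
    (ψ : (ℓ : ℕ) → (ZMod ℓ)ˣ →* Multiplicative (ZMod (p ^ k)))
    (hψ : ∀ ℓ ∈ (1 : ℕ).primeFactors, Function.Surjective (ψ ℓ))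
    (h : kuriharaNumber f (p ^ k) 1 ψ ≠ 0) :
    W.selmerCorank p ≤ (1 : ℕ).primeFactors.card :=
  Kim2022_selmerCorank_le_of_kuriharaNumber_ne_zero_one_of_kato
    (fun W _ _ p _ ↦ kato_finite_of_L_one_ne_zero_of_rank_eq_analyticRank W p hGZK)
    W p hp hgood hord hsurj f hf hper k hk hn ψ hψ h

end Assembly

/-! ### Levels `ν(n) < p` from an order-of-vanishing bound on the Mazur–Tate element -/

section MazurTateOrder

variable {N : ℕ} (f : CuspForm (Gamma0 N) 2) (p : ℕ) [Fact p.Prime]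

/-- **Truncated order of vanishing ⇒ the bound at levels `ν(n) < p`** (pure algebra). If the
`p`-integral structure `Θ ∈ ℤ_p[(ℤ/n)ˣ]` of the modular element `θ̃_f(n) = ∑_a [a/n]⁺_f δ_a` lies
in `I^{min(r, p)}` (the shape of Ota 2018, Thm. 5.17, with `r` the Selmer corank), `ν(n) < p`, and
the Kurihara number `kuriharaNumber f (p^k) n ψ` is non-zero, then `r ≤ ν(n)`: by
`le_card_primeFactors_of_kuriharaNumber_ne_zero` (`δ_n` is the top Taylor coefficient of `Θ`,
which kills `I^{ν(n)+1}`) one has `min(r, p) ≤ ν(n) < p`, so the minimum is `r`.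
[cite: Ota2018, Thm. 5.17 (§5.5, PDF p. 21)] [cite: Kurihara2014, §1.1 (1)–(2) (PDF p. 2)] -/
theorem le_card_primeFactors_of_kuriharaNumber_ne_zero_of_mem_pow_min (k n : ℕ) [NeZero n]
    (ψ : (ℓ : ℕ) → (ZMod ℓ)ˣ →* Multiplicative (ZMod (p ^ k)))
    {Θ : MonoidAlgebra ℤ_[p] (ZMod n)ˣ}
    (hΘ : ∀ a : (ZMod n)ˣ, ((Θ.coeff a : ℤ_[p]) : ℚ_[p]) =
      ((ratPlusSymbol f (((a : ZMod n).val : ℚ) / n) : ℚ) : ℚ_[p]))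
    {r : ℕ} (hmem : Θ ∈ MazurTate.augIdeal ℤ_[p] (ZMod n)ˣ ^ min r p)
    (hν : n.primeFactors.card < p) (hne : kuriharaNumber f (p ^ k) n ψ ≠ 0) :
    r ≤ n.primeFactors.card := by
  have hmin : min r p ≤ n.primeFactors.card :=
    le_card_primeFactors_of_kuriharaNumber_ne_zero f p k n ψ hΘ hmem hne
  rcases Nat.le_total r p with h | h
  · rwa [Nat.min_eq_left h] at hmin
  · rw [Nat.min_eq_right h] at hmin
    omega

/-- **Kim 2022, Thm. 1.9 (1), upper direction, at every level `n` with `ν(n) < p`, granted the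
order of vanishing of the Mazur–Tate element** — with every binder of
`Kim2022_selmerCorank_le_of_kuriharaNumber_ne_zero` in place, plus `ν(n) < p` and the hypothesis
`hMT`: the `p`-integral structure of `θ̃_f(n) = ∑_{a ∈ (ℤ/n)ˣ} [a/n]⁺_f δ_a` exists and lies in
`I^{min(corank_{ℤ_p} Sel_{p^∞}(E/ℚ), p)} ⊆ ℤ_p[(ℤ/n)ˣ]`. That hypothesis is the conclusion of
Ota's theorem (Amer. J. Math. 140 (2018), Thm. 5.17: "`θ_S ∈ I_{G_S}^{min{r_{p^∞}, p}} ⊆ ℤ_p[G_S]`",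
plus part, `Ω⁺_f`-normalisation — module docstring) at `S = n`, available in print when moreover
`p ∤ #Ẽ(𝔽_p)`, `p ∤ Tam(E)` and `Ẽ(𝔽_ℓ)[p]` is cyclic for every `ℓ ∣ n` (the fact's `5 ≤ p`,
good reduction at `p`, `ρ̄_{E,p}` onto — hence `ρ_{E,p^∞}` onto by
`serre_hasSurjectiveModNGaloisRep_pow_holds` — and `n ∈ 𝒩_k` square-free with prime factors
`ℓ ∤ N_E p` supply Ota's remaining hypotheses). Conclusion: `kuriharaNumber f (p^k) n ψ ≠ 0 ⇒
corank_{ℤ_p} Sel_{p^∞}(E/ℚ) ≤ ν(n)`. The hypotheses on `p`, `ρ̄`, the period transfer, `k`,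
`n ∈ 𝒩_k` and the `ψ_ℓ` are not used by this deduction (they are kept to match the fact; they are
what makes `hMT` a theorem in print). [cite: Kim2022StructureSelmer, Thm. 1.9 (1) (PDF p. 7), §3.5 (PDF p. 19)]
[cite: Ota2018, Thm. 5.17 (§5.5, PDF p. 21)] -/
theorem Kim2022_selmerCorank_le_of_kuriharaNumber_ne_zero_of_mazurTateOrder
    (W : WeierstrassCurve ℚ) [W.IsElliptic] [W.IsGloballyMinimal] (p : ℕ) [Fact p.Prime]
    (_hp : 5 ≤ p) (_hgood : W.HasGoodReductionAtPrime p) (_hord : ¬ (p : ℤ) ∣ W.frobeniusTrace p)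
    (_hsurj : W.HasSurjectiveModNGaloisRep p)
    {N : ℕ} [NeZero N] (f : CuspForm (CongruenceSubgroup.Gamma0 N) 2) (_hf : IsNewformOf W f)
    (_hper : ∃ u : ℚ, ‖(u : ℚ_[p])‖ = 1 ∧ W.realPeriodRat = u * plusPeriod f)
    (k n : ℕ) [NeZero n] (_hk : 1 ≤ k) (_hn : Kato.IsKolyvaginProduct W p k n)
    (hν : n.primeFactors.card < p)
    (hMT : ∃ Θ : MonoidAlgebra ℤ_[p] (ZMod n)ˣ,
      (∀ a : (ZMod n)ˣ, ((Θ.coeff a : ℤ_[p]) : ℚ_[p]) =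
        ((ratPlusSymbol f (((a : ZMod n).val : ℚ) / n) : ℚ) : ℚ_[p])) ∧
      Θ ∈ MazurTate.augIdeal ℤ_[p] (ZMod n)ˣ ^ min (W.selmerCorank p) p)
    (ψ : (ℓ : ℕ) → (ZMod ℓ)ˣ →* Multiplicative (ZMod (p ^ k)))
    (_hψ : ∀ ℓ ∈ n.primeFactors, Function.Surjective (ψ ℓ))
    (h : kuriharaNumber f (p ^ k) n ψ ≠ 0) :
    W.selmerCorank p ≤ n.primeFactors.card := by
  obtain ⟨Θ, hΘ, hmem⟩ := hMT
  exact le_card_primeFactors_of_kuriharaNumber_ne_zero_of_mem_pow_min f p k n ψ hΘ hmem hν h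

/-- **The fact at ALL levels, granted the untruncated order of vanishing** `θ̃_f(n) ∈ I^{cork} ⊗
ℤ_p` (the Selmer-corank form of the Mazur–Tate weak vanishing conjecture at level `n`: Mazur–Tate
1987; Ota 2018, Conj. 1.1 / Thm. 5.17 without the truncation at `p`): with every binder of
`Kim2022_selmerCorank_le_of_kuriharaNumber_ne_zero` in place and `hMT'` in place of Kim's
Kolyvagin-system argument, `kuriharaNumber f (p^k) n ψ ≠ 0 ⇒ corank_{ℤ_p} Sel_{p^∞}(E/ℚ) ≤ ν(n)`
(`le_card_primeFactors_of_kuriharaNumber_ne_zero`). This isolates exactly what the printed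
Thm. 1.9 (1) adds to the Mazur–Tate picture: the order-of-vanishing bound beyond order `p` and at
anomalous / `p ∣ Tam(E)` / non-cyclic data. [cite: Kim2022StructureSelmer, Thm. 1.9 (1) (PDF p. 7), §3.5 (PDF p. 19)]
[cite: Ota2018, Conj. 1.1 and Thm. 5.17] -/
theorem Kim2022_selmerCorank_le_of_kuriharaNumber_ne_zero_of_mazurTateOrder'
    (W : WeierstrassCurve ℚ) [W.IsElliptic] [W.IsGloballyMinimal] (p : ℕ) [Fact p.Prime]
    (_hp : 5 ≤ p) (_hgood : W.HasGoodReductionAtPrime p) (_hord : ¬ (p : ℤ) ∣ W.frobeniusTrace p)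
    (_hsurj : W.HasSurjectiveModNGaloisRep p)
    {N : ℕ} [NeZero N] (f : CuspForm (CongruenceSubgroup.Gamma0 N) 2) (_hf : IsNewformOf W f)
    (_hper : ∃ u : ℚ, ‖(u : ℚ_[p])‖ = 1 ∧ W.realPeriodRat = u * plusPeriod f)
    (k n : ℕ) [NeZero n] (_hk : 1 ≤ k) (_hn : Kato.IsKolyvaginProduct W p k n)
    (hMT' : ∃ Θ : MonoidAlgebra ℤ_[p] (ZMod n)ˣ,
      (∀ a : (ZMod n)ˣ, ((Θ.coeff a : ℤ_[p]) : ℚ_[p]) =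
        ((ratPlusSymbol f (((a : ZMod n).val : ℚ) / n) : ℚ) : ℚ_[p])) ∧
      Θ ∈ MazurTate.augIdeal ℤ_[p] (ZMod n)ˣ ^ W.selmerCorank p)
    (ψ : (ℓ : ℕ) → (ZMod ℓ)ˣ →* Multiplicative (ZMod (p ^ k)))
    (_hψ : ∀ ℓ ∈ n.primeFactors, Function.Surjective (ψ ℓ))
    (h : kuriharaNumber f (p ^ k) n ψ ≠ 0) :
    W.selmerCorank p ≤ n.primeFactors.card := by
  obtain ⟨Θ, hΘ, hmem⟩ := hMT'
  exact le_card_primeFactors_of_kuriharaNumber_ne_zero f p k n ψ hΘ hmem h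

/-- **Kim 2022, Thm. 1.9 (1), upper direction, at all levels `ν(n) < p` under Ota's hypotheses,
granting Ota's theorem.** The hypothesis `hOta` is the transcription (plus part,
`Ω⁺_f`-normalisation; see the module docstring and the draft fact
`ota_modularElement_mem_augIdeal_pow`) of K. Ota, Amer. J. Math. 140 (2018), **Thm. 5.17**: for a
globally minimal `W`, a prime `p ≥ 5` with `p ∤ N_E`, `p ∤ #Ẽ(𝔽_p)`, `p ∤ ∏ c_ℓ` and `ρ̄_{E,p^m}`
onto for all `m`, the newform `f` of `W` with `Ω(E) = u Ω⁺_f` (`|u|_p = 1`), and a square-free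
`S` whose prime factors `ℓ` satisfy `ℓ ∤ N_E` and `#Ẽ(𝔽_ℓ)[p] ≤ p`, the `p`-integral structure
of `θ̃_f(S)` exists and lies in `I^{min(cork_{ℤ_p} Sel_{p^∞}(E/ℚ), p)}`. With every binder of
`Kim2022_selmerCorank_le_of_kuriharaNumber_ne_zero` in place plus Ota's three extra hypotheses
at `(p, n)` (`hna`, `htam`, `hcyc`) and `ν(n) < p`: `kuriharaNumber f (p^k) n ψ ≠ 0 ⇒
corank_{ℤ_p} Sel_{p^∞}(E/ℚ) ≤ ν(n)`. Proof: good reduction gives `p ∤ N_E`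
(`not_dvd_conductorNorm_of_hasGoodReductionAtPrime`), Serre's lemma gives the `p`-adic
surjectivity (`serre_hasSurjectiveModNGaloisRep_pow_holds`, `p ≥ 5`), `n ∈ 𝒩_k` gives `n`
square-free with prime factors `ℓ ∤ N_E p` (`Kato.IsKolyvaginProduct`), so `hOta` applies at
`S = n`, and `Kim2022_selmerCorank_le_of_kuriharaNumber_ne_zero_of_mazurTateOrder` concludes.
[cite: Kim2022StructureSelmer, Thm. 1.9 (1) (PDF p. 7), §3.5 (PDF p. 19)]
[cite: Ota2018, Thm. 5.17 (§5.5, PDF p. 21)] -/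
theorem Kim2022_selmerCorank_le_of_kuriharaNumber_ne_zero_of_otaStatement
    (hOta : ∀ (W : WeierstrassCurve ℚ) [W.IsElliptic] [W.IsGloballyMinimal] (p : ℕ) [Fact p.Prime],
      5 ≤ p → ¬ p ∣ W.conductorNorm ℤ → ¬ p ∣ W.reductionPointCount p → ¬ p ∣ W.tamagawaProduct →
      (∀ m : ℕ, W.HasSurjectiveModNGaloisRep (p ^ m : ℕ)) →
      ∀ {N : ℕ} [NeZero N] (f : CuspForm (CongruenceSubgroup.Gamma0 N) 2), IsNewformOf W f →
      (∃ u : ℚ, ‖(u : ℚ_[p])‖ = 1 ∧ W.realPeriodRat = u * plusPeriod f) →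
      ∀ (S : ℕ) [NeZero S], Squarefree S →
      (∀ (ℓ : ℕ) [Fact ℓ.Prime], ℓ ∣ S →
        ¬ ℓ ∣ W.conductorNorm ℤ ∧
          Nat.card {P : ((WeierstrassCurve.integralModelInt W).map
              (Int.castRingHom (ZMod ℓ))).toAffine.Point // p • P = 0} ≤ p) →
      ∃ Θ : MonoidAlgebra ℤ_[p] (ZMod S)ˣ,
        (∀ a : (ZMod S)ˣ, ((Θ.coeff a : ℤ_[p]) : ℚ_[p]) =
          ((ratPlusSymbol f (((a : ZMod S).val : ℚ) / S) : ℚ) : ℚ_[p])) ∧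
        Θ ∈ MazurTate.augIdeal ℤ_[p] (ZMod S)ˣ ^ min (W.selmerCorank p) p)
    (W : WeierstrassCurve ℚ) [W.IsElliptic] [W.IsGloballyMinimal] (p : ℕ) [Fact p.Prime]
    (hp : 5 ≤ p) (hgood : W.HasGoodReductionAtPrime p) (_hord : ¬ (p : ℤ) ∣ W.frobeniusTrace p)
    (hsurj : W.HasSurjectiveModNGaloisRep p)
    {N : ℕ} [NeZero N] (f : CuspForm (CongruenceSubgroup.Gamma0 N) 2) (hf : IsNewformOf W f)
    (hper : ∃ u : ℚ, ‖(u : ℚ_[p])‖ = 1 ∧ W.realPeriodRat = u * plusPeriod f)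
    (k n : ℕ) [NeZero n] (_hk : 1 ≤ k) (hn : Kato.IsKolyvaginProduct W p k n)
    (hna : ¬ p ∣ W.reductionPointCount p) (htam : ¬ p ∣ W.tamagawaProduct)
    (hcyc : ∀ (ℓ : ℕ) [Fact ℓ.Prime], ℓ ∣ n →
      Nat.card {P : ((WeierstrassCurve.integralModelInt W).map
          (Int.castRingHom (ZMod ℓ))).toAffine.Point // p • P = 0} ≤ p)
    (hν : n.primeFactors.card < p)
    (ψ : (ℓ : ℕ) → (ZMod ℓ)ˣ →* Multiplicative (ZMod (p ^ k)))
    (hψ : ∀ ℓ ∈ n.primeFactors, Function.Surjective (ψ ℓ))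
    (h : kuriharaNumber f (p ^ k) n ψ ≠ 0) :
    W.selmerCorank p ≤ n.primeFactors.card := by
  have hN : ¬ p ∣ W.conductorNorm ℤ := not_dvd_conductorNorm_of_hasGoodReductionAtPrime W hgood
  have hsur : ∀ m : ℕ, W.HasSurjectiveModNGaloisRep (p ^ m : ℕ) :=
    serre_hasSurjectiveModNGaloisRep_pow_holds W p hp hsurj
  have hS : ∀ (ℓ : ℕ) [Fact ℓ.Prime], ℓ ∣ n →
      ¬ ℓ ∣ W.conductorNorm ℤ ∧
        Nat.card {P : ((WeierstrassCurve.integralModelInt W).map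
            (Int.castRingHom (ZMod ℓ))).toAffine.Point // p • P = 0} ≤ p :=
    fun ℓ _ hℓn => ⟨(hn.isKolyvaginPrime Fact.out hℓn).not_dvd_conductorNorm, hcyc ℓ hℓn⟩
  have hMT := hOta W p hp hN hna htam hsur f hf hper n hn.squarefree hS
  exact Kim2022_selmerCorank_le_of_kuriharaNumber_ne_zero_of_mazurTateOrder W p hp hgood _hord
    hsurj f hf hper k n _hk hn hν hMT ψ hψ h

end MazurTateOrder

end Literature.NumberTheory.EllipticCurves
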